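import Literature.ModelTheory.ExponentialFields.Languages
import Summits.Schanuel.Schanuel.Theorems.ZilberEacComplexCyclicCover
import HarnessLib

/-!
# EC over cyclic covers and complex spheres: the varieties

EC-vocabulary corollaries of `exists_expPoint_cyclicCoverBM_avoiding`
(`ZilberEacComplexCyclicCover.lean`; first open rung of Exponential-Algebraic Closedness
`dim π₁(V) = n - 1`, Mantova–Masser, PLMS 129 (2024), §1 p. 5):

* `cyclicCoverBM_inter_expGraph_nonempty` — the `(s+1)`-fold
  `V = {xₙ^e = P(x'), (x', (yⱼ - yₙ Fⱼ(yₙ, xₙ, x'))ⱼ) ∈ W} ⊆ ℂⁿ × (ℂˣ)ⁿ` meets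
  `Literature.NumberTheory.Transcendental.expGraph`;
* `exists_expPoint_sphereBM`, `sphereBM_inter_expGraph_nonempty` — **EC over the complex
  spheres**: for every `r ∈ ℂ`, every Brownawell–Masser variety `W ⊆ ℂ^{s+1} × ℂ^{s+1}` and
  arbitrary `Fⱼ`, the `(s+2)`-fold `{x₁² + ⋯ + x_{s+2}² = r, (x', (yⱼ - y_{s+2} Fⱼ(y_{s+2}, x_{s+2}, x'))ⱼ) ∈ W}`
  meets the graph of `exp` (`e = 2`, `P = r - Σ xᵢ²`, `ω = -1`, `q₀ = e₁`: `P₂(2πi e₁) = 4π²`).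
  The sphere has degree `2` in every variable, so it is not a graph over any coordinate
  hyperplane and none of the earlier graph-base theorems applies.

HONEST FRAMING: a modest new sub-rung of EAC; nothing here bears on Schanuel's conjecture.
-/

noncomputable section

open Complex MvPolynomial Metric Set Filter Topology
open Literature.NumberTheory.Transcendental

set_option linter.dupNamespace false

namespace Summit.Schanuel.Schanuel.Theorems

/-! ### Cyclic covers: the EC vocabulary -/

/-- **The cyclic-cover varieties meet the graph of exponentiation.** With `n = s + 1`, under the
hypotheses of `exists_expPoint_cyclicCoverBM_avoiding` (`e ≥ 1`, `deg P ≥ 1`, `ω^e = 1`,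
`P_D(2πi q₀) ∉ (-∞,0]`, `Re(ω P_D(2πi q₀)^{1/e}) < 0`, `W` Brownawell–Masser), the subvariety
`V = {xₙ^e = P(x₁..xₛ), (x', (yⱼ - yₙ Fⱼ(yₙ, xₙ, x'))ⱼ) ∈ W}` of `ℂⁿ × ℂⁿ` (points
`z : Fin n ⊕ Fin n → ℂ`; distinguished last coordinate `Fin.last s`) contains a point of
`Literature.NumberTheory.Transcendental.expGraph ℂ n`, hence of `ℂⁿ × (ℂˣ)ⁿ`.
[cite: MantovaMasser2023, §1 p.5 (the open case dim π(V) = 2 in ℂ³×ℂˣ³)] -/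
theorem cyclicCoverBM_inter_expGraph_nonempty {s : ℕ} {e : ℕ} (he : 0 < e)
    (P : MvPolynomial (Fin s) ℂ) (hD : 0 < P.totalDegree) (q₀ : Fin s → ℤ) (ω : ℂ) (hω : ω ^ e = 1)
    (hslit : eval (fun j => 2 * Real.pi * I * (q₀ j : ℂ))
      (homogeneousComponent P.totalDegree P) ∈ slitPlane)
    (hsign : (ω * (eval (fun j => 2 * Real.pi * I * (q₀ j : ℂ))
      (homogeneousComponent P.totalDegree P)) ^ ((e : ℂ)⁻¹)).re < 0)
    (W : Set (Fin s ⊕ Fin s → ℂ)) (hW : IsIrreducibleClosed ℂ W) (hdim : zariskiDim ℂ W = s)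
    (hdom : HasDominantAddProjection ℂ (W ∩ torusLocus ℂ s))
    (F : Fin s → MvPolynomial (Fin (s + 2)) ℂ) :
    ({z : Fin (s + 1) ⊕ Fin (s + 1) → ℂ |
        z (Sum.inl (Fin.last s)) ^ e = eval (fun j => z (Sum.inl (Fin.castSucc j))) P ∧
        (Sum.elim (fun j => z (Sum.inl (Fin.castSucc j)))
            (fun j => z (Sum.inr (Fin.castSucc j)) - z (Sum.inr (Fin.last s)) *
              eval (Fin.cons (z (Sum.inr (Fin.last s)))
                (Fin.cons (z (Sum.inl (Fin.last s))) (fun i => z (Sum.inl (Fin.castSucc i))) :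
                  Fin (s + 1) → ℂ)) (F j)) : Fin s ⊕ Fin s → ℂ) ∈ W} ∩
      Literature.NumberTheory.Transcendental.expGraph ℂ (s + 1)).Nonempty := by
  obtain ⟨x, xn, -, hxn, hx⟩ := exists_expPoint_cyclicCoverBM_avoiding he P hD q₀ ω hω hslit hsign
    W hW hdim hdom F 1 one_ne_zero
  set X : Fin (s + 1) → ℂ := Fin.snoc x xn with hX
  refine ⟨Sum.elim X fun i => exp (X i), ⟨?_, ?_⟩, fun i => ?_⟩
  · simp only [Sum.elim_inl, hX, Fin.snoc_last, Fin.snoc_castSucc]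
    exact hxn
  · simp only [Sum.elim_inl, Sum.elim_inr, hX, Fin.snoc_castSucc, Fin.snoc_last]
    exact hx
  · simp [Literature.ModelTheory.ExponentialFields.ExponentialRing.complex_exp_eq]

/-! ### The complex spheres -/

/-- `(4π²)^{1/2}`-type positivity: for real `x > 0`, `Re(-1 · x^{1/2}) < 0` (principal branch).
[folklore] -/
theorem re_neg_one_mul_ofReal_cpow_neg {x : ℝ} (hx : 0 < x) (y : ℝ) :
    ((-1 : ℂ) * ((x : ℂ)) ^ (y : ℂ)).re < 0 := by
  rw [← Complex.ofReal_cpow hx.le, neg_one_mul, Complex.neg_re, Complex.ofReal_re, neg_lt_zero]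
  exact Real.rpow_pos_of_pos hx y

/-- **Exponential points over the complex sphere with Brownawell–Masser puncture fibre.** For
every `r ∈ ℂ`, every Brownawell–Masser variety `W ⊆ ℂ^{s+1} × ℂ^{s+1}` (irreducible,
`dim W = s + 1`, dominant additive projection of the torus part), arbitrary
`Fⱼ ∈ ℂ[u, w, x₁..x_{s+1}]` and `h ≠ 0`, there are `x' ∈ ℂ^{s+1}`, `xₙ ∈ ℂ` with `h(x') ≠ 0`,
`xₙ² + Σᵢ xᵢ'² = r` and `(x', (e^{xⱼ} - e^{xₙ} Fⱼ(e^{xₙ}, xₙ, x'))ⱼ) ∈ W` — an exponential point of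
the `(s+2)`-fold over the complex sphere `x₁² + ⋯ + x_{s+2}² = r`
(`exists_expPoint_cyclicCoverBM_avoiding` with `e = 2`, `P = r - Σ xᵢ²`, `ω = -1`, `q₀ = e₁`,
`P₂(2πi e₁) = 4π² > 0`). New case of Exponential-Algebraic Closedness with a non-graph base
(first open range `dim π₁ V = n - 1`, Mantova–Masser 2024 §1 p. 5).
[cite: MantovaMasser2023, §1 p.5 (the open case dim π(V) = 2 in ℂ³×ℂˣ³)] -/
theorem exists_expPoint_sphereBM_avoiding {s : ℕ} (r : ℂ)
    (W : Set (Fin (s + 1) ⊕ Fin (s + 1) → ℂ)) (hW : IsIrreducibleClosed ℂ W)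
    (hdim : zariskiDim ℂ W = (s + 1 : ℕ))
    (hdom : HasDominantAddProjection ℂ (W ∩ torusLocus ℂ (s + 1)))
    (F : Fin (s + 1) → MvPolynomial (Fin (s + 1 + 2)) ℂ) (h : MvPolynomial (Fin (s + 1)) ℂ)
    (hh : h ≠ 0) :
    ∃ x : Fin (s + 1) → ℂ, ∃ xn : ℂ, eval x h ≠ 0 ∧ xn ^ 2 + ∑ i, x i ^ 2 = r ∧
      (Sum.elim x (fun j => exp (x j) - exp xn *
        eval (Fin.cons (exp xn) (Fin.cons xn x : Fin (s + 2) → ℂ)) (F j)) :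
          Fin (s + 1) ⊕ Fin (s + 1) → ℂ) ∈ W := by
  classical
  -- the polynomial `P = r - Σ xᵢ²` and its leading form `-Σ xᵢ²`
  set S2 : MvPolynomial (Fin (s + 1)) ℂ := ∑ i, X i ^ 2 with hS2
  set P : MvPolynomial (Fin (s + 1)) ℂ := -S2 + C r with hP
  have hS2hom : S2.IsHomogeneous 2 :=
    IsHomogeneous.sum _ _ 2 fun i _ => isHomogeneous_X_pow i 2
  have hS2eval : ∀ x : Fin (s + 1) → ℂ, eval x S2 = ∑ i, x i ^ 2 := fun x => by
    simp [hS2, map_sum, map_pow, eval_X]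
  have hPeval : ∀ x : Fin (s + 1) → ℂ, eval x P = -(∑ i, x i ^ 2) + r := fun x => by
    rw [hP, map_add, map_neg, hS2eval, eval_C]
  -- the direction `q₀ = e₁`
  set q₀ : Fin (s + 1) → ℤ := fun j => if j = 0 then 1 else 0 with hq₀
  have hv : (fun j : Fin (s + 1) => 2 * (Real.pi : ℂ) * I * ((q₀ j : ℤ) : ℂ)) =
      fun j => if j = 0 then 2 * Real.pi * I else 0 := by
    funext j
    by_cases hj : j = 0
    · simp [hq₀, hj]
    · simp [hq₀, hj]
  have hsumv : ∑ i : Fin (s + 1), ((fun j : Fin (s + 1) => if j = 0 then 2 * (Real.pi : ℂ) * I else 0) i) ^ 2 =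
      (2 * Real.pi * I) ^ 2 := by
    rw [Fin.sum_univ_succ]
    simp [Fin.succ_ne_zero]
  have hS2v : eval (fun j : Fin (s + 1) => 2 * (Real.pi : ℂ) * I * ((q₀ j : ℤ) : ℂ)) S2 =
      ((-4 * Real.pi ^ 2 : ℝ) : ℂ) := by
    rw [hv, hS2eval, hsumv]
    push_cast
    ring_nf
    rw [Complex.I_sq]
    ring
  have hS2ne : S2 ≠ 0 := by
    intro h0
    have := hS2v
    rw [h0, map_zero] at this
    have h1 : ((-4 * Real.pi ^ 2 : ℝ) : ℂ) = 0 := this.symm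
    rw [Complex.ofReal_eq_zero] at h1
    have := Real.pi_pos
    nlinarith
  have hdegS2 : S2.totalDegree = 2 := hS2hom.totalDegree hS2ne
  have hdegP : P.totalDegree = 2 := by
    rw [hP, totalDegree_add_eq_left_of_totalDegree_lt, totalDegree_neg, hdegS2]
    rw [totalDegree_neg, hdegS2, totalDegree_C]; norm_num
  have hPtop : homogeneousComponent P.totalDegree P = -S2 := by
    rw [hdegP, hP, map_add, map_neg, homogeneousComponent_eq_self hS2hom,
      homogeneousComponent_of_mem (isHomogeneous_C _ r)]
    simp
  have hPtopv : eval (fun j : Fin (s + 1) => 2 * (Real.pi : ℂ) * I * ((q₀ j : ℤ) : ℂ))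
      (homogeneousComponent P.totalDegree P) = ((4 * Real.pi ^ 2 : ℝ) : ℂ) := by
    rw [hPtop, map_neg, hS2v]
    push_cast; ring
  have h4pi : (0 : ℝ) < 4 * Real.pi ^ 2 := by have := Real.pi_pos; positivity
  have hslit : eval (fun j : Fin (s + 1) => 2 * (Real.pi : ℂ) * I * ((q₀ j : ℤ) : ℂ))
      (homogeneousComponent P.totalDegree P) ∈ slitPlane := by
    rw [hPtopv]; exact Complex.ofReal_mem_slitPlane.mpr h4pi
  have hsign : ((-1 : ℂ) * (eval (fun j : Fin (s + 1) => 2 * (Real.pi : ℂ) * I * ((q₀ j : ℤ) : ℂ))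
      (homogeneousComponent P.totalDegree P)) ^ (((2 : ℕ) : ℂ)⁻¹)).re < 0 := by
    rw [hPtopv, Literature.Geometry.ComplexAnalytic.PhamBrieskorn.natCast_inv_eq]
    exact re_neg_one_mul_ofReal_cpow_neg h4pi _
  obtain ⟨x, xn, hxh, hxn, hx⟩ := exists_expPoint_cyclicCoverBM_avoiding (e := 2) (by norm_num) P
    (by rw [hdegP]; norm_num) q₀ (-1) (by norm_num) hslit hsign W hW hdim hdom F h hh
  refine ⟨x, xn, hxh, ?_, hx⟩
  rw [hxn, hPeval]
  ring

/-- **The varieties over the complex sphere meet the graph of exponentiation** (EC vocabulary):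
with `n = s + 2`, for every `r ∈ ℂ`, every Brownawell–Masser `W ⊆ ℂ^{s+1} × ℂ^{s+1}` and
arbitrary `Fⱼ`, the subvariety
`V = {x₁² + ⋯ + xₙ² = r, (x', (yⱼ - yₙ Fⱼ(yₙ, xₙ, x'))ⱼ) ∈ W}` of `ℂⁿ × ℂⁿ` (`x' = (x₁..x_{n-1})`,
distinguished last coordinate `Fin.last (s+1)`) contains a point of
`Literature.NumberTheory.Transcendental.expGraph ℂ n`. Its additive projection is the complex
sphere (dimension `n - 1`), which is not a graph over any coordinate hyperplane.
[cite: MantovaMasser2023, §1 p.5 (the open case dim π(V) = 2 in ℂ³×ℂˣ³)] -/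
theorem sphereBM_inter_expGraph_nonempty {s : ℕ} (r : ℂ)
    (W : Set (Fin (s + 1) ⊕ Fin (s + 1) → ℂ)) (hW : IsIrreducibleClosed ℂ W)
    (hdim : zariskiDim ℂ W = (s + 1 : ℕ))
    (hdom : HasDominantAddProjection ℂ (W ∩ torusLocus ℂ (s + 1)))
    (F : Fin (s + 1) → MvPolynomial (Fin (s + 1 + 2)) ℂ) :
    ({z : Fin (s + 2) ⊕ Fin (s + 2) → ℂ |
        ∑ i, z (Sum.inl i) ^ 2 = r ∧
        (Sum.elim (fun j => z (Sum.inl (Fin.castSucc j)))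
            (fun j => z (Sum.inr (Fin.castSucc j)) - z (Sum.inr (Fin.last (s + 1))) *
              eval (Fin.cons (z (Sum.inr (Fin.last (s + 1))))
                (Fin.cons (z (Sum.inl (Fin.last (s + 1))))
                  (fun i => z (Sum.inl (Fin.castSucc i))) : Fin (s + 2) → ℂ)) (F j)) :
            Fin (s + 1) ⊕ Fin (s + 1) → ℂ) ∈ W} ∩
      Literature.NumberTheory.Transcendental.expGraph ℂ (s + 2)).Nonempty := by
  obtain ⟨x, xn, -, hxn, hx⟩ := exists_expPoint_sphereBM_avoiding r W hW hdim hdom F 1 one_ne_zero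
  set X : Fin (s + 2) → ℂ := Fin.snoc x xn with hX
  refine ⟨Sum.elim X fun i => exp (X i), ⟨?_, ?_⟩, fun i => ?_⟩
  · simp only [Sum.elim_inl]
    rw [Fin.sum_univ_castSucc]
    simp only [hX, Fin.snoc_castSucc, Fin.snoc_last]
    rw [add_comm]; exact hxn
  · simp only [Sum.elim_inl, Sum.elim_inr, hX, Fin.snoc_castSucc, Fin.snoc_last]
    exact hx
  · simp [Literature.ModelTheory.ExponentialFields.ExponentialRing.complex_exp_eq]

end Summit.Schanuel.Schanuel.Theorems
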